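import Summits.CriticalPhenomena.PercolationContinuityZ3.Theorems.PercNearOneGluingNoHeavyLowerTailForestRayleighKFourCells
import Summits.CriticalPhenomena.PercolationContinuityZ3.Theorems.PercNearOneGluingNoHeavyLowerTailForestRayleighRelabel
import Summits.CriticalPhenomena.PercolationContinuityZ3.Theorems.PercNearOneGluingNoHeavyLowerTailForestRayleighTreewidthTwo
import HarnessLib

/-!
# Weighted forest negative correlation — `K₄` II: every instance inside `K₄` (vertex set `Fin 4`)

Notation as in `…ForestRayleighTools`: `Z(D;K) = Σ_{G ⊆ D, ⟨G ∪ K⟩ acyclic} ∏ w`,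
`(R)(D;K;e,f) : Z(D;K∪{e,f})·Z(D;K) ≤ Z(D;K∪e)·Z(D;K∪f)`.

**Theorem (`forestsW_rayleigh_K4_fin`).** For all activities `w ≥ 0` on the six edges of `K₄`
(vertices `Fin 4`), all disjoint `D, K` and `e ≠ f` outside `D ∪ K` with `D ∪ K ∪ {e,f} ⊆ E(K₄)`,
`(R)(D;K;e,f)` holds — the cycle matroid `M(K₄)` and all its minors are *independence
correlated* [Semple–Welsh, CPC 17 (2008), §4 (via a Maple computation for `AG(3,2)`) and
Thm. 4.2: `K₄` is the unique excluded minor for *strong* (coefficientwise) correlation of binary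
matroids]. Proof: an instance missing an edge `g` lives in `K₄ − g`, which has tree-width 2
(`forestsW_rayleigh_of_elimOrder` with an explicit elimination order); an instance using all six
edges is, up to a symmetry of `K₄` (transported by `lsm_image`) and `e ↔ f`, one of the five cells
of `…KFourCells` or has a cycle inside `K ∪ {e,f}` (then `(R)` reads `0 ≤ RHS`).
Theorems only; no definitions, no `sorry`.
-/

open Finset SimpleGraph
open scoped Classical

namespace Summit.CriticalPhenomena.PercolationContinuityZ3.Theorems.ForestRayleigh

section General

variable {V : Type*} [Fintype V] [DecidableEq V]

omit [Fintype V] in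
/-- `(R)` is trivial when the pinned set `K ∪ {e,f}` already contains a cycle. [elementary] -/
theorem lsm_of_not_isAcyclic_pin (w : Sym2 V → ℝ) (hw : ∀ x, 0 ≤ w x) (D K : Finset (Sym2 V))
    (e f : Sym2 V)
    (h : ¬(fromEdgeSet ((insert e (insert f K) : Finset (Sym2 V)) : Set (Sym2 V))).IsAcyclic) :
    (∑ G ∈ D.powerset.filter (fun G =>
        (fromEdgeSet ((G ∪ (insert e (insert f K)) : Finset (Sym2 V)) : Set (Sym2 V))).IsAcyclic), ∏ x ∈ G, w x) *
      (∑ G ∈ D.powerset.filter (fun G =>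
        (fromEdgeSet ((G ∪ K : Finset (Sym2 V)) : Set (Sym2 V))).IsAcyclic), ∏ x ∈ G, w x) ≤
    (∑ G ∈ D.powerset.filter (fun G =>
        (fromEdgeSet ((G ∪ (insert e K) : Finset (Sym2 V)) : Set (Sym2 V))).IsAcyclic), ∏ x ∈ G, w x) *
      (∑ G ∈ D.powerset.filter (fun G =>
        (fromEdgeSet ((G ∪ (insert f K) : Finset (Sym2 V)) : Set (Sym2 V))).IsAcyclic), ∏ x ∈ G, w x) := by
  rw [forestsW_eq_zero_of_not_isAcyclic w D _ h, zero_mul]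
  exact mul_nonneg (forestsW_nonneg w hw D _) (forestsW_nonneg w hw D _)

omit [Fintype V] in
/-- In an instance using every edge of `T`, the free set is determined by the pinned one.
[elementary] -/
theorem free_eq_sdiff_of_full {T D K : Finset (Sym2 V)} {e f : Sym2 V}
    (hsub : D ∪ insert e (insert f K) ⊆ T) (hfull : T ⊆ D ∪ insert e (insert f K))
    (hDK : Disjoint D K) (heD : e ∉ D) (hfD : f ∉ D) : D = T \ insert e (insert f K) := by
  ext z
  rw [Finset.mem_sdiff, Finset.mem_insert, Finset.mem_insert]
  constructor
  · intro hz
    refine ⟨hsub (Finset.mem_union_left _ hz), ?_⟩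
    rintro (rfl | rfl | hzK)
    · exact heD hz
    · exact hfD hz
    · exact Finset.disjoint_left.1 hDK hz hzK
  · rintro ⟨hzT, hz⟩
    rcases Finset.mem_union.1 (hfull hzT) with h | h
    · exact h
    · rw [Finset.mem_insert, Finset.mem_insert] at h
      exact absurd h hz

omit [Fintype V] in
/-- The pinned set of an instance inside `T` avoids `e, f`. [elementary] -/
theorem pins_subset_erase {T D K : Finset (Sym2 V)} {e f : Sym2 V}
    (hsub : D ∪ insert e (insert f K) ⊆ T) (heK : e ∉ K) (hfK : f ∉ K) :
    K ⊆ (T.erase e).erase f := by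
  intro z hz
  rw [Finset.mem_erase, Finset.mem_erase]
  exact ⟨fun h => hfK (h ▸ hz), fun h => heK (h ▸ hz),
    hsub (Finset.mem_union_right _ (Finset.mem_insert_of_mem (Finset.mem_insert_of_mem hz)))⟩

end General

/-! ### §1 Instances using all six edges, `e = 01` -/

set_option maxHeartbeats 400000 in
/-- `(R)` for every instance inside `K₄` using all six edges with `e = s(0, 1)`, `f = s(0, 2)`.
[S–W 2008 §4] -/
theorem K4_full_01_02 (w : Sym2 (Fin 4) → ℝ) (hw : ∀ x, 0 ≤ w x) (D K : Finset (Sym2 (Fin 4)))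
    (hsub : D ∪ insert s(0, 1) (insert s(0, 2) K) ⊆ ({s(0, 1), s(0, 2), s(0, 3), s(1, 2), s(1, 3), s(2, 3)} : Finset (Sym2 (Fin 4))))
    (hfull : ({s(0, 1), s(0, 2), s(0, 3), s(1, 2), s(1, 3), s(2, 3)} : Finset (Sym2 (Fin 4))) ⊆ D ∪ insert s(0, 1) (insert s(0, 2) K))
    (hDK : Disjoint D K) (heD : s(0, 1) ∉ D) (heK : s(0, 1) ∉ K) (hfD : s(0, 2) ∉ D)
    (hfK : s(0, 2) ∉ K) :
    (∑ G ∈ D.powerset.filter (fun G =>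
        (fromEdgeSet ((G ∪ (insert s(0, 1) (insert s(0, 2) (K))) : Finset (Sym2 (Fin 4))) : Set (Sym2 (Fin 4)))).IsAcyclic), ∏ x ∈ G, w x) *
      (∑ G ∈ D.powerset.filter (fun G =>
        (fromEdgeSet ((G ∪ (K) : Finset (Sym2 (Fin 4))) : Set (Sym2 (Fin 4)))).IsAcyclic), ∏ x ∈ G, w x) ≤
    (∑ G ∈ D.powerset.filter (fun G =>
        (fromEdgeSet ((G ∪ (insert s(0, 1) (K)) : Finset (Sym2 (Fin 4))) : Set (Sym2 (Fin 4)))).IsAcyclic), ∏ x ∈ G, w x) *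
      (∑ G ∈ D.powerset.filter (fun G =>
        (fromEdgeSet ((G ∪ (insert s(0, 2) (K)) : Finset (Sym2 (Fin 4))) : Set (Sym2 (Fin 4)))).IsAcyclic), ∏ x ∈ G, w x) := by
  have hDeq := free_eq_sdiff_of_full hsub hfull hDK heD hfD
  have hKR := Finset.mem_powerset.2 (pins_subset_erase hsub heK hfK)
  rw [show ((({s(0, 1), s(0, 2), s(0, 3), s(1, 2), s(1, 3), s(2, 3)} : Finset (Sym2 (Fin 4)))).erase s(0, 1)).erase s(0, 2) = ({s(0, 3), s(1, 2), s(1, 3), s(2, 3)} : Finset (Sym2 (Fin 4))) from by decide,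
    show (({s(0, 3), s(1, 2), s(1, 3), s(2, 3)} : Finset (Sym2 (Fin 4)))).powerset = {∅, {s(0, 3)}, {s(1, 2)}, {s(1, 3)}, {s(2, 3)}, {s(0, 3), s(1, 2)}, {s(0, 3), s(1, 3)}, {s(0, 3), s(2, 3)}, {s(1, 2), s(1, 3)}, {s(1, 2), s(2, 3)}, {s(1, 3), s(2, 3)}, {s(0, 3), s(1, 2), s(1, 3)}, {s(0, 3), s(1, 2), s(2, 3)}, {s(0, 3), s(1, 3), s(2, 3)}, {s(1, 2), s(1, 3), s(2, 3)}, {s(0, 3), s(1, 2), s(1, 3), s(2, 3)}} from by decide] at hKR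
  simp only [Finset.mem_insert, Finset.mem_singleton] at hKR
  rcases hKR with rfl | rfl | rfl | rfl | rfl | rfl | rfl | rfl | rfl | rfl | rfl | rfl | rfl | rfl | rfl | rfl
  · -- K = ∅
    rw [show ({s(0, 1), s(0, 2), s(0, 3), s(1, 2), s(1, 3), s(2, 3)} : Finset (Sym2 (Fin 4))) \ insert s(0, 1) (insert s(0, 2) (∅ : Finset (Sym2 (Fin 4)))) =
        ({s(0, 3), s(1, 2), s(1, 3), s(2, 3)} : Finset (Sym2 (Fin 4))) from by decide] at hDeq
    subst hDeq
    exact K4_adj_free w hw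
  · -- K = {s(0, 3)}
    rw [show ({s(0, 1), s(0, 2), s(0, 3), s(1, 2), s(1, 3), s(2, 3)} : Finset (Sym2 (Fin 4))) \ insert s(0, 1) (insert s(0, 2) ({s(0, 3)} : Finset (Sym2 (Fin 4)))) =
        ({s(1, 2), s(1, 3), s(2, 3)} : Finset (Sym2 (Fin 4))) from by decide] at hDeq
    subst hDeq
    exact K4_adj_pin_ad w hw
  · -- K = {s(1, 2)}
    exact lsm_of_not_isAcyclic_pin w hw D _ _ _ (by
      rw [isAcyclic_iff_forall_adj_not_reachable_erase]; decide)
  · -- K = {s(1, 3)}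
    rw [show ({s(0, 1), s(0, 2), s(0, 3), s(1, 2), s(1, 3), s(2, 3)} : Finset (Sym2 (Fin 4))) \ insert s(0, 1) (insert s(0, 2) ({s(1, 3)} : Finset (Sym2 (Fin 4)))) =
        ({s(0, 3), s(1, 2), s(2, 3)} : Finset (Sym2 (Fin 4))) from by decide] at hDeq
    subst hDeq
    have h := K4_adj_pin_cd (fun x => w (Sym2.map ⇑(Equiv.swap (1 : Fin 4) 2) x)) (fun x => hw _)
    have h2 := lsm_image (⇑(Equiv.swap (1 : Fin 4) 2)) (Equiv.injective _) w ({s(0, 3), s(1, 2), s(1, 3)} : Finset (Sym2 (Fin 4)))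
      ({s(2, 3)} : Finset (Sym2 (Fin 4))) s(0, 1) s(0, 2) (by decide) h
    simp only [show (({s(0, 3), s(1, 2), s(1, 3)} : Finset (Sym2 (Fin 4)))).image (Sym2.map ⇑(Equiv.swap (1 : Fin 4) 2)) = ({s(0, 3), s(1, 2), s(2, 3)} : Finset (Sym2 (Fin 4))) from by decide,
      show (({s(2, 3)} : Finset (Sym2 (Fin 4)))).image (Sym2.map ⇑(Equiv.swap (1 : Fin 4) 2)) = ({s(1, 3)} : Finset (Sym2 (Fin 4))) from by decide,
      show Sym2.map ⇑(Equiv.swap (1 : Fin 4) 2) s(0, 1) = (s(0, 2) : Sym2 (Fin 4)) from by decide,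
      show Sym2.map ⇑(Equiv.swap (1 : Fin 4) 2) s(0, 2) = (s(0, 1) : Sym2 (Fin 4)) from by decide] at h2
    exact lsm_symm w _ _ _ _ h2
  · -- K = {s(2, 3)}
    rw [show ({s(0, 1), s(0, 2), s(0, 3), s(1, 2), s(1, 3), s(2, 3)} : Finset (Sym2 (Fin 4))) \ insert s(0, 1) (insert s(0, 2) ({s(2, 3)} : Finset (Sym2 (Fin 4)))) =
        ({s(0, 3), s(1, 2), s(1, 3)} : Finset (Sym2 (Fin 4))) from by decide] at hDeq
    subst hDeq
    exact K4_adj_pin_cd w hw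
  · -- K = {s(0, 3), s(1, 2)}
    exact lsm_of_not_isAcyclic_pin w hw D _ _ _ (by
      rw [isAcyclic_iff_forall_adj_not_reachable_erase]; decide)
  · -- K = {s(0, 3), s(1, 3)}
    exact lsm_of_not_isAcyclic_pin w hw D _ _ _ (by
      rw [isAcyclic_iff_forall_adj_not_reachable_erase]; decide)
  · -- K = {s(0, 3), s(2, 3)}
    exact lsm_of_not_isAcyclic_pin w hw D _ _ _ (by
      rw [isAcyclic_iff_forall_adj_not_reachable_erase]; decide)
  · -- K = {s(1, 2), s(1, 3)}
    exact lsm_of_not_isAcyclic_pin w hw D _ _ _ (by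
      rw [isAcyclic_iff_forall_adj_not_reachable_erase]; decide)
  · -- K = {s(1, 2), s(2, 3)}
    exact lsm_of_not_isAcyclic_pin w hw D _ _ _ (by
      rw [isAcyclic_iff_forall_adj_not_reachable_erase]; decide)
  · -- K = {s(1, 3), s(2, 3)}
    exact lsm_of_not_isAcyclic_pin w hw D _ _ _ (by
      rw [isAcyclic_iff_forall_adj_not_reachable_erase]; decide)
  · -- K = {s(0, 3), s(1, 2), s(1, 3)}
    exact lsm_of_not_isAcyclic_pin w hw D _ _ _ (by
      rw [isAcyclic_iff_forall_adj_not_reachable_erase]; decide)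
  · -- K = {s(0, 3), s(1, 2), s(2, 3)}
    exact lsm_of_not_isAcyclic_pin w hw D _ _ _ (by
      rw [isAcyclic_iff_forall_adj_not_reachable_erase]; decide)
  · -- K = {s(0, 3), s(1, 3), s(2, 3)}
    exact lsm_of_not_isAcyclic_pin w hw D _ _ _ (by
      rw [isAcyclic_iff_forall_adj_not_reachable_erase]; decide)
  · -- K = {s(1, 2), s(1, 3), s(2, 3)}
    exact lsm_of_not_isAcyclic_pin w hw D _ _ _ (by
      rw [isAcyclic_iff_forall_adj_not_reachable_erase]; decide)
  · -- K = {s(0, 3), s(1, 2), s(1, 3), s(2, 3)}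
    exact lsm_of_not_isAcyclic_pin w hw D _ _ _ (by
      rw [isAcyclic_iff_forall_adj_not_reachable_erase]; decide)

set_option maxHeartbeats 400000 in
/-- `(R)` for every instance inside `K₄` using all six edges with `e = s(0, 1)`, `f = s(2, 3)`.
[S–W 2008 §4] -/
theorem K4_full_01_23 (w : Sym2 (Fin 4) → ℝ) (hw : ∀ x, 0 ≤ w x) (D K : Finset (Sym2 (Fin 4)))
    (hsub : D ∪ insert s(0, 1) (insert s(2, 3) K) ⊆ ({s(0, 1), s(0, 2), s(0, 3), s(1, 2), s(1, 3), s(2, 3)} : Finset (Sym2 (Fin 4))))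
    (hfull : ({s(0, 1), s(0, 2), s(0, 3), s(1, 2), s(1, 3), s(2, 3)} : Finset (Sym2 (Fin 4))) ⊆ D ∪ insert s(0, 1) (insert s(2, 3) K))
    (hDK : Disjoint D K) (heD : s(0, 1) ∉ D) (heK : s(0, 1) ∉ K) (hfD : s(2, 3) ∉ D)
    (hfK : s(2, 3) ∉ K) :
    (∑ G ∈ D.powerset.filter (fun G =>
        (fromEdgeSet ((G ∪ (insert s(0, 1) (insert s(2, 3) (K))) : Finset (Sym2 (Fin 4))) : Set (Sym2 (Fin 4)))).IsAcyclic), ∏ x ∈ G, w x) *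
      (∑ G ∈ D.powerset.filter (fun G =>
        (fromEdgeSet ((G ∪ (K) : Finset (Sym2 (Fin 4))) : Set (Sym2 (Fin 4)))).IsAcyclic), ∏ x ∈ G, w x) ≤
    (∑ G ∈ D.powerset.filter (fun G =>
        (fromEdgeSet ((G ∪ (insert s(0, 1) (K)) : Finset (Sym2 (Fin 4))) : Set (Sym2 (Fin 4)))).IsAcyclic), ∏ x ∈ G, w x) *
      (∑ G ∈ D.powerset.filter (fun G =>
        (fromEdgeSet ((G ∪ (insert s(2, 3) (K)) : Finset (Sym2 (Fin 4))) : Set (Sym2 (Fin 4)))).IsAcyclic), ∏ x ∈ G, w x) := by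
  have hDeq := free_eq_sdiff_of_full hsub hfull hDK heD hfD
  have hKR := Finset.mem_powerset.2 (pins_subset_erase hsub heK hfK)
  rw [show ((({s(0, 1), s(0, 2), s(0, 3), s(1, 2), s(1, 3), s(2, 3)} : Finset (Sym2 (Fin 4)))).erase s(0, 1)).erase s(2, 3) = ({s(0, 2), s(0, 3), s(1, 2), s(1, 3)} : Finset (Sym2 (Fin 4))) from by decide,
    show (({s(0, 2), s(0, 3), s(1, 2), s(1, 3)} : Finset (Sym2 (Fin 4)))).powerset = {∅, {s(0, 2)}, {s(0, 3)}, {s(1, 2)}, {s(1, 3)}, {s(0, 2), s(0, 3)}, {s(0, 2), s(1, 2)}, {s(0, 2), s(1, 3)}, {s(0, 3), s(1, 2)}, {s(0, 3), s(1, 3)}, {s(1, 2), s(1, 3)}, {s(0, 2), s(0, 3), s(1, 2)}, {s(0, 2), s(0, 3), s(1, 3)}, {s(0, 2), s(1, 2), s(1, 3)}, {s(0, 3), s(1, 2), s(1, 3)}, {s(0, 2), s(0, 3), s(1, 2), s(1, 3)}} from by decide] at hKR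
  simp only [Finset.mem_insert, Finset.mem_singleton] at hKR
  rcases hKR with rfl | rfl | rfl | rfl | rfl | rfl | rfl | rfl | rfl | rfl | rfl | rfl | rfl | rfl | rfl | rfl
  · -- K = ∅
    rw [show ({s(0, 1), s(0, 2), s(0, 3), s(1, 2), s(1, 3), s(2, 3)} : Finset (Sym2 (Fin 4))) \ insert s(0, 1) (insert s(2, 3) (∅ : Finset (Sym2 (Fin 4)))) =
        ({s(0, 2), s(0, 3), s(1, 2), s(1, 3)} : Finset (Sym2 (Fin 4))) from by decide] at hDeq
    subst hDeq
    exact K4_opp_free w hw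
  · -- K = {s(0, 2)}
    rw [show ({s(0, 1), s(0, 2), s(0, 3), s(1, 2), s(1, 3), s(2, 3)} : Finset (Sym2 (Fin 4))) \ insert s(0, 1) (insert s(2, 3) ({s(0, 2)} : Finset (Sym2 (Fin 4)))) =
        ({s(0, 3), s(1, 2), s(1, 3)} : Finset (Sym2 (Fin 4))) from by decide] at hDeq
    subst hDeq
    have h := K4_opp_pin (fun x => w (Sym2.map ⇑(Equiv.swap (0 : Fin 4) 1 * Equiv.swap (2 : Fin 4) 3) x)) (fun x => hw _)
    have h2 := lsm_image (⇑(Equiv.swap (0 : Fin 4) 1 * Equiv.swap (2 : Fin 4) 3)) (Equiv.injective _) w ({s(0, 2), s(0, 3), s(1, 2)} : Finset (Sym2 (Fin 4)))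
      ({s(1, 3)} : Finset (Sym2 (Fin 4))) s(0, 1) s(2, 3) (by decide) h
    simp only [show (({s(0, 2), s(0, 3), s(1, 2)} : Finset (Sym2 (Fin 4)))).image (Sym2.map ⇑(Equiv.swap (0 : Fin 4) 1 * Equiv.swap (2 : Fin 4) 3)) = ({s(0, 3), s(1, 2), s(1, 3)} : Finset (Sym2 (Fin 4))) from by decide,
      show (({s(1, 3)} : Finset (Sym2 (Fin 4)))).image (Sym2.map ⇑(Equiv.swap (0 : Fin 4) 1 * Equiv.swap (2 : Fin 4) 3)) = ({s(0, 2)} : Finset (Sym2 (Fin 4))) from by decide,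
      show Sym2.map ⇑(Equiv.swap (0 : Fin 4) 1 * Equiv.swap (2 : Fin 4) 3) s(0, 1) = (s(0, 1) : Sym2 (Fin 4)) from by decide,
      show Sym2.map ⇑(Equiv.swap (0 : Fin 4) 1 * Equiv.swap (2 : Fin 4) 3) s(2, 3) = (s(2, 3) : Sym2 (Fin 4)) from by decide] at h2
    exact h2
  · -- K = {s(0, 3)}
    rw [show ({s(0, 1), s(0, 2), s(0, 3), s(1, 2), s(1, 3), s(2, 3)} : Finset (Sym2 (Fin 4))) \ insert s(0, 1) (insert s(2, 3) ({s(0, 3)} : Finset (Sym2 (Fin 4)))) =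
        ({s(0, 2), s(1, 2), s(1, 3)} : Finset (Sym2 (Fin 4))) from by decide] at hDeq
    subst hDeq
    have h := K4_opp_pin (fun x => w (Sym2.map ⇑(Equiv.swap (0 : Fin 4) 1) x)) (fun x => hw _)
    have h2 := lsm_image (⇑(Equiv.swap (0 : Fin 4) 1)) (Equiv.injective _) w ({s(0, 2), s(0, 3), s(1, 2)} : Finset (Sym2 (Fin 4)))
      ({s(1, 3)} : Finset (Sym2 (Fin 4))) s(0, 1) s(2, 3) (by decide) h
    simp only [show (({s(0, 2), s(0, 3), s(1, 2)} : Finset (Sym2 (Fin 4)))).image (Sym2.map ⇑(Equiv.swap (0 : Fin 4) 1)) = ({s(0, 2), s(1, 2), s(1, 3)} : Finset (Sym2 (Fin 4))) from by decide,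
      show (({s(1, 3)} : Finset (Sym2 (Fin 4)))).image (Sym2.map ⇑(Equiv.swap (0 : Fin 4) 1)) = ({s(0, 3)} : Finset (Sym2 (Fin 4))) from by decide,
      show Sym2.map ⇑(Equiv.swap (0 : Fin 4) 1) s(0, 1) = (s(0, 1) : Sym2 (Fin 4)) from by decide,
      show Sym2.map ⇑(Equiv.swap (0 : Fin 4) 1) s(2, 3) = (s(2, 3) : Sym2 (Fin 4)) from by decide] at h2
    exact h2
  · -- K = {s(1, 2)}
    rw [show ({s(0, 1), s(0, 2), s(0, 3), s(1, 2), s(1, 3), s(2, 3)} : Finset (Sym2 (Fin 4))) \ insert s(0, 1) (insert s(2, 3) ({s(1, 2)} : Finset (Sym2 (Fin 4)))) =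
        ({s(0, 2), s(0, 3), s(1, 3)} : Finset (Sym2 (Fin 4))) from by decide] at hDeq
    subst hDeq
    have h := K4_opp_pin (fun x => w (Sym2.map ⇑(Equiv.swap (2 : Fin 4) 3) x)) (fun x => hw _)
    have h2 := lsm_image (⇑(Equiv.swap (2 : Fin 4) 3)) (Equiv.injective _) w ({s(0, 2), s(0, 3), s(1, 2)} : Finset (Sym2 (Fin 4)))
      ({s(1, 3)} : Finset (Sym2 (Fin 4))) s(0, 1) s(2, 3) (by decide) h
    simp only [show (({s(0, 2), s(0, 3), s(1, 2)} : Finset (Sym2 (Fin 4)))).image (Sym2.map ⇑(Equiv.swap (2 : Fin 4) 3)) = ({s(0, 2), s(0, 3), s(1, 3)} : Finset (Sym2 (Fin 4))) from by decide,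
      show (({s(1, 3)} : Finset (Sym2 (Fin 4)))).image (Sym2.map ⇑(Equiv.swap (2 : Fin 4) 3)) = ({s(1, 2)} : Finset (Sym2 (Fin 4))) from by decide,
      show Sym2.map ⇑(Equiv.swap (2 : Fin 4) 3) s(0, 1) = (s(0, 1) : Sym2 (Fin 4)) from by decide,
      show Sym2.map ⇑(Equiv.swap (2 : Fin 4) 3) s(2, 3) = (s(2, 3) : Sym2 (Fin 4)) from by decide] at h2
    exact h2
  · -- K = {s(1, 3)}
    rw [show ({s(0, 1), s(0, 2), s(0, 3), s(1, 2), s(1, 3), s(2, 3)} : Finset (Sym2 (Fin 4))) \ insert s(0, 1) (insert s(2, 3) ({s(1, 3)} : Finset (Sym2 (Fin 4)))) =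
        ({s(0, 2), s(0, 3), s(1, 2)} : Finset (Sym2 (Fin 4))) from by decide] at hDeq
    subst hDeq
    exact K4_opp_pin w hw
  · -- K = {s(0, 2), s(0, 3)}
    exact lsm_of_not_isAcyclic_pin w hw D _ _ _ (by
      rw [isAcyclic_iff_forall_adj_not_reachable_erase]; decide)
  · -- K = {s(0, 2), s(1, 2)}
    exact lsm_of_not_isAcyclic_pin w hw D _ _ _ (by
      rw [isAcyclic_iff_forall_adj_not_reachable_erase]; decide)
  · -- K = {s(0, 2), s(1, 3)}
    exact lsm_of_not_isAcyclic_pin w hw D _ _ _ (by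
      rw [isAcyclic_iff_forall_adj_not_reachable_erase]; decide)
  · -- K = {s(0, 3), s(1, 2)}
    exact lsm_of_not_isAcyclic_pin w hw D _ _ _ (by
      rw [isAcyclic_iff_forall_adj_not_reachable_erase]; decide)
  · -- K = {s(0, 3), s(1, 3)}
    exact lsm_of_not_isAcyclic_pin w hw D _ _ _ (by
      rw [isAcyclic_iff_forall_adj_not_reachable_erase]; decide)
  · -- K = {s(1, 2), s(1, 3)}
    exact lsm_of_not_isAcyclic_pin w hw D _ _ _ (by
      rw [isAcyclic_iff_forall_adj_not_reachable_erase]; decide)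
  · -- K = {s(0, 2), s(0, 3), s(1, 2)}
    exact lsm_of_not_isAcyclic_pin w hw D _ _ _ (by
      rw [isAcyclic_iff_forall_adj_not_reachable_erase]; decide)
  · -- K = {s(0, 2), s(0, 3), s(1, 3)}
    exact lsm_of_not_isAcyclic_pin w hw D _ _ _ (by
      rw [isAcyclic_iff_forall_adj_not_reachable_erase]; decide)
  · -- K = {s(0, 2), s(1, 2), s(1, 3)}
    exact lsm_of_not_isAcyclic_pin w hw D _ _ _ (by
      rw [isAcyclic_iff_forall_adj_not_reachable_erase]; decide)
  · -- K = {s(0, 3), s(1, 2), s(1, 3)}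
    exact lsm_of_not_isAcyclic_pin w hw D _ _ _ (by
      rw [isAcyclic_iff_forall_adj_not_reachable_erase]; decide)
  · -- K = {s(0, 2), s(0, 3), s(1, 2), s(1, 3)}
    exact lsm_of_not_isAcyclic_pin w hw D _ _ _ (by
      rw [isAcyclic_iff_forall_adj_not_reachable_erase]; decide)

end Summit.CriticalPhenomena.PercolationContinuityZ3.Theorems.ForestRayleigh
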